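import Summits.QuantumFields.QCD.Theses.SpectralDefectExtinction
import Literature.MathematicalPhysics.QuantumFieldTheory.QCDPhaseQuenched
import Literature.MathematicalPhysics.QuantumFieldTheory.SpectralDefectDensity
import Literature.Barriers.QuantumFields.WilsonDeterminantMassSplitting
import Summits.QuantumFields.QCD.Theorems.PauliWegnerSeaTiltedFlatnessStubEulerWord
import Summits.QuantumFields.QCD.Theorems.PauliWegnerSeaTiltedFlatnessStubCircleUntilt

/-!
# Crux `SpectralDefectExtinction.WegnerEstimate` (stmt-QuantumFields-8966), line `Sketch`
(skeleton "ResolventCell") — stub `stub_untilt`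

**What is proved.** `stub_untilt`: the ball-free β-ELIMINATION on `SU(3)^E`.  Let
`T(θ) = diag(e^{iθ}, e^{-iθ}, 1)`.  For every `n` and `K` there are `C > 0` and `p ≥ 0` such that for
every finite `E`, every list `r : ι → E` of at most `n` coordinates and every continuous `S` on
`E → SU(3)` that depends only on the listed coordinates and is `K`-Lipschitz along every circle
`s ↦ W[r i ↦ A T(s) B]`, the tilted law `e^{-βS} Haar^{⊗E} / Z` has density `≤ C (1+β)^p` for every
`β ≥ 0`, in the multiplicative form `e^{-βS(W)} ≤ C (1+β)^p · Z`, `Z = ∫ e^{-βS} dHaar^{⊗E}`.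

**Proof.** This is the composition of two LANDED theorems of the line `circle-transport` of crux
`TiltedFlatness`:
* `CircleTransport.stub_eulerWord` — every `g ∈ SU(3)` is a fixed word of `d = 9` conjugated circles
  `∏ⱼ Vⱼ T(sⱼ) Vⱼ⁻¹` (generalized Euler angles), and
* `CircleTransport.stub_circleUntilt` — GIVEN such a surjective word, the density bound in the quotient
  form `e^{-βS(W)} / Z ≤ C (1+β)^p` (left invariance of product Haar + Tonelli couple `Z` to the angle
  average along the word fibre through any `W`, which reaches a global minimiser of `S`; per-angle
  `K`-Lipschitz gives `Z ≥ e^{-βS_min - 1} (h/2π)^m` while `e^{-βS} ≤ e^{-βS_min}`).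
To pass from the quotient form to the multiplicative form we show `Z > 0` (`untilt_integral_pos`: the
integrand is continuous and positive on the compact space `E → SU(3)` and product Haar is a
probability measure), and we replace the exponent `p` by `max p 0` using `1 + β ≥ 1`
(`Real.rpow_le_rpow_of_exponent_le`), so that the advertised `0 ≤ p` holds.

Sources: folklore (Haar averaging along one-parameter subgroups; generalized Euler angles for
`SU(3)`); the certified-TRUE audit of the same statement (`FibreDensity` / `stub_circleUntilt`) in
`Cruxes/TiltedFlatness/Disproof.lean`.  No unproved named fact of the tree is used.
-/

noncomputable section

namespace Summit.QuantumFields.QCD.Cruxes.WegnerEstimate.ResolventCell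

open MeasureTheory
open scoped Matrix BigOperators
open Literature.MathematicalPhysics.QuantumLattice Literature.MathematicalPhysics.QuantumFieldTheory
  Literature.Probability.LatticeModels
open Matrix

/-- The partition function of a continuous tilt against product Haar on `SU(3)^E` is positive:
`0 < ∫ e^{-βS} dHaar^{⊗E}` (the integrand is continuous, hence integrable on the compact configuration
space, and everywhere positive; product Haar is a probability measure). -/
theorem untilt_integral_pos (E : Type) [Fintype E] (S : (E → SU3) → ℝ) (hS : Continuous S) (β : ℝ) :
    0 < ∫ W', Real.exp (-(β * S W')) ∂(Measure.pi fun _ : E => haarProbability SU3) := by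
  have hcont : Continuous fun W' : E → SU3 => -(β * S W') := (continuous_const.mul hS).neg
  exact integral_exp_pos
    (Summit.QuantumFields.QCD.Theorems.TiltedFlatnessNegative.integrable_of_continuous
      (Real.continuous_exp.comp hcont))

/-- **Stub `untilt` (ball-free β-elimination on `SU(3)^E`, abstract).**  Let
`T(θ) = diag(e^{iθ}, e^{-iθ}, 1)`.  For every `n` and `K` there are `C > 0` and `p ≥ 0` such that for
every finite `E`, every list `r : ι → E` of at most `n` coordinates and every continuous `S` on
`E → SU(3)` that depends only on the listed coordinates and is `K`-Lipschitz along every circle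
`s ↦ W[r i ↦ A T(s) B]`, the tilted law `e^{-βS} Haar^{⊗E}/Z` has density `≤ C (1+β)^p` for every
`β ≥ 0`: `e^{-βS(W)} ≤ C(1+β)^p ∫ e^{-βS} dHaar^{⊗E}` for all `W`.  (Euler word
`CircleTransport.stub_eulerWord` + the untilt `CircleTransport.stub_circleUntilt`, both landed;
positivity of `Z` converts the quotient bound into the product bound.) -/
theorem stub_untilt (T : ℝ → SU3)
    (hT : ∀ θ : ℝ, ((T θ : SU3) : Matrix (Fin 3) (Fin 3) ℂ) =
      Matrix.diagonal ![Complex.exp (θ * Complex.I), Complex.exp (-(θ * Complex.I)), 1])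
    (n : ℕ) (K : ℝ) :
    ∃ C p : ℝ, 0 < C ∧ 0 ≤ p ∧
      ∀ (E : Type) [Fintype E] [DecidableEq E] (ι : Type) [Fintype ι] (r : ι → E), Fintype.card ι ≤ n →
      ∀ S : (E → SU3) → ℝ, Continuous S →
        (∀ W W' : E → SU3, (∀ i, W (r i) = W' (r i)) → S W = S W') →
        (∀ (W : E → SU3) (i : ι) (A B : SU3) (s s' : ℝ),
          |S (Function.update W (r i) (A * T s * B)) -
              S (Function.update W (r i) (A * T s' * B))| ≤ K * |s - s'|) →
        ∀ β : ℝ, 0 ≤ β → ∀ W : E → SU3,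
          Real.exp (-(β * S W)) ≤
            C * (1 + β) ^ p * ∫ W', Real.exp (-(β * S W')) ∂(Measure.pi fun _ : E => haarProbability SU3) := by
  obtain ⟨C, p, hC, H⟩ :=
    Summit.QuantumFields.QCD.Theorems.CircleTransport.stub_circleUntilt T hT
      (Summit.QuantumFields.QCD.Theorems.CircleTransport.stub_eulerWord T hT) n K
  refine ⟨C, max p 0, hC, le_max_right p 0, ?_⟩
  intro E _ _ ι _ r hcard S hSc hdep hlip β hβ W
  have hZ := untilt_integral_pos E S hSc β
  have h1 := (div_le_iff₀ hZ).1 (H E ι r hcard S hSc hdep hlip β hβ W)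
  refine h1.trans (mul_le_mul_of_nonneg_right (mul_le_mul_of_nonneg_left ?_ hC.le) hZ.le)
  exact Real.rpow_le_rpow_of_exponent_le (by linarith) (le_max_left p 0)

end Summit.QuantumFields.QCD.Cruxes.WegnerEstimate.ResolventCell
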